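import Summits.RiemannHypothesis.RiemannHypothesis.Theorems.TiltedLandingLaw421R3LooseRecutAdapt

/-! # Lens2_probe75 — post-land BY-IMPORT probe of TREE #1225 = 75 `…Theorems.TiltedLandingLaw421R3LooseRecutAdapt` (5dda30dd76959414 · 183 l); lens-2 g10 O11-a.
Imports ONLY the tree module. (P1) `RhW08.LooseRecutAdapt.approachRecut_of_TH_count_canonical` at `c = 4/5, κ₀ = 3` has EXACTLY the v12q `stub_approachRecutC`
literal type (conclusion written FQ); (P2) `law421R_of_recut_count` concludes the crux decl BY NAME; (P3) axioms. Workfile; registry v11q untouched.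
RH is not proved; 33346/33347 OPEN; checked ≠ landed ≠ proved. -/
namespace RhW08.Lens2Probe75

open RhW08.Round1 RhW08.StSwap RhW08.Round2 RhW08.QuadW
open RhW08.SealSwap (PBot)
open RhW08.SealSwapQ RhW08.RateSplit RhW08.BurgersRate RhW08.BurgersRateG3 RhW08.TouchedDissipation RhW08.TouchedDissipationW
open RhIdea6.G17.W07C7 RhIdea6.G17.W07C7.Rev6 RhIdea6.G18.W07C8.Law421BirthS RhIdea6.G19.W07C11.Seam
open RhIdea6.G20.W07C12.Frac RhIdea6.G20.W07C12.StColP RhW07.C12.FieldSplit RhIdea6.G21.W07C13.TentMax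
open RhW07.C14.TwoSided RhW07.C14.Classes RhW07.C14.Lineage RhW07.C14.Booking
open RhW08.PurseP RhW08.TouchedGlueW RhW08.TouchedGlueH RhW08.TouchedGlueHAdapt RhW08.TouchedGlueHCount RhW08.LooseRecut

/-- (P1) READ-BACK of the v12q `stub_approachRecutC` literal type from the TREE theorem (c = 4/5, κ₀ = 3); conclusion written fully qualified. -/
example {cF : Budget} {L : ℝ} {aT aRest : Budget}
    (hcF : ∀ (η : ℝ) (f : ℂ → ℂ) (x₀ s hmax R Hs : ℝ) (B : ℕ), EngineHyps5 2 η f x₀ s hmax R Hs B → 0 < cF η f x₀ s hmax R Hs B)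
    (hL : 0 ≤ L) (hT : TouchedDissipationLawWQ cF L 3) (hrise : TouchRiseLawHQ cF L 3 aT)
    (hrest : ClassLawQ (diffClass (diffClass ApproachLevelQ (LooseLevelQ (4 / 5) (BetaLevelQ 3))) (BetaLevelQ 3)) aRest)
    (hfit : ∀ (η : ℝ) (f : ℂ → ℂ) (x₀ s hmax R Hs : ℝ) (B : ℕ), EngineHyps5 2 η f x₀ s hmax R Hs B →
      betaUsedQ 3 (addBudget (betaCountCapQ 3 (betaPurseWQ cF L)) aT) η f x₀ s hmax R Hs B + aRest η f x₀ s hmax R Hs B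
        ≤ approachBudgetHalfQ riseSupQ consSupQ η f x₀ s hmax R Hs B) :
    RhW08.LooseRecut.ApproachRecutAllowanceQ (4 / 5) (RhW08.TouchedGlueW.BetaLevelQ 3)
      (RhW08.RateSplit.approachBudgetHalfQ RhW08.BurgersRateG3.riseSupQ RhW08.BurgersRateG3.consSupQ) :=
  RhW08.LooseRecutAdapt.approachRecut_of_TH_count_canonical hcF hL hT hrise hrest hfit
/-- (P2) the residual-typed closing theorem of the TREE module concludes the CRUX DECL by name (all named hypotheses explicit). -/
example {cF : Budget} {L κ₀ : ℝ} {aT : Budget} (hP : RhW08.Lens1Pinning.TopPinning) (hU : RhW08.Lens1Pinning.RegUmbrella11S)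
    (hR2 : FarEnergyLawCQ (4 / 5)) (hr : EnergyRiseLawQ riseSupQ) (hC : ConsLawQ consSupQ)
    (hcF : ∀ (η : ℝ) (f : ℂ → ℂ) (x₀ s hmax R Hs : ℝ) (B : ℕ), EngineHyps5 2 η f x₀ s hmax R Hs B → 0 < cF η f x₀ s hmax R Hs B)
    (hL : 0 ≤ L) (hT : TouchedDissipationLawWQ cF L κ₀) (hrise : TouchRiseLawHQ cF L κ₀ aT)
    (hrest : ClassLawQ (diffClass (diffClass ApproachLevelQ (LooseLevelQ (4 / 5) (BetaLevelQ κ₀))) (BetaLevelQ κ₀))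
      (restResidualQ κ₀ cF L aT (approachBudgetHalfQ riseSupQ consSupQ))) :
    Summit.RiemannHypothesis.RiemannHypothesis.Theses.EarlyAppointments.TiltedLandingLaw421R :=
  RhW08.LooseRecutAdapt.law421R_of_recut_count hP hU hR2 hr hC hcF hL hT hrise hrest

/-- info: 'RhW08.LooseRecutAdapt.approachRecut_of_TH_count_canonical' depends on axioms: [propext, Classical.choice, Quot.sound] -/
#guard_msgs in #print axioms RhW08.LooseRecutAdapt.approachRecut_of_TH_count_canonical
end RhW08.Lens2Probe75
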